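import Summits.BirchSwinnertonDyer.BirchSwinnertonDyer.Theorems.ClassRecordThreeEulerHalvesAtThreeEichlerShimuraTorsionCountG
import Literature.Geometry.Kaehler.ComplexTorusQuaternionUnitGroupFinitelyGeneratedSplit
import HarnessLib

/-!
# The torsion-refined Shapiro count over a field `K`, part H: the INTEGRAL RANK BOUND at level `Γ`

Helper file (route `ClassRecordThree`, crux `EulerHalvesAtThree`, print residue (SIGᶜ-lift)(ii); seat bsd-idea-10 g24, `--supports
stmt-BirchSwinnertonDyer-19109 --as helper`). The level-`Γ` form of the hypothesis `hV` of the lifting recipe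
`…EichlerShimuraModLift.parabolicCochain_modLift_of_rankBound`: for a finite-index level `Γ ≤ SL(2, ℤ)` with `-1 ∈ Γ`, an integral basis
`e₁, …, e_r` of the lattice of additive parabolic-null maps `Γ → ℤ` (unique coordinates), and ANY prime `p`,

  `rankBound_level`: every `𝔽_p`-linearly independent family of additive maps `Γ → 𝔽_p` killing the parabolic and the finite-order elements has
  `≤ r` members,

by the chain `s ≤ dim_{𝔽_p} H¹_{par,tors}(Γ, 𝔽_p) ≤ dim_ℚ H¹_{par,tors}(Γ, ℚ) ≤ r`: the first step is linear algebra, the second is the torsion-refined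
count (part D: `≤ 2g` over EVERY field) against the exact count in characteristic `0` (part G: `= 2g`), the third clears denominators
(`exists_int_eq_mul_of_additive`: an additive `u : Γ → ℚ` on the finitely generated `Γ` is `u'/d` with `u'` integral, and `u' = ∑ cᵢeᵢ`).
What remains for (SIGᶜ-lift)(ii)-split is the TRANSPORT `ι(O¹) ≅ Γ ≤ SL(2, ℤ)` for a split quaternion algebra (matching `GL`-parabolicity with
integral parabolicity and finite order with finite order) — dossier `Cruxes/EulerHalvesAtThree/Lines/es-surj-gamma-transfer.md` §6. No named facts;
nothing specific to BSD; no summit statement is proved.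

## References
* G. Shimura, *Introduction to the arithmetic theory of automorphic functions* (1971), §8.1–8.2 [ShimuraIATAF1971].
* O. Schreier (finite-index subgroups of finitely generated groups are finitely generated), via Mathlib `Subgroup.fg_of_index_ne_zero`.
-/

noncomputable section

open scoped MatrixGroups ModularForm

open CongruenceSubgroup Matrix.SpecialLinearGroup ModularGroup

set_option linter.dupNamespace false

namespace Summit.BirchSwinnertonDyer.BirchSwinnertonDyer.Theorems.EichlerShimuraLevelK

open _root_.Module _root_.LinearMap
open Literature.NumberTheory.EllipticCurves.ModularForms
open scoped Classical

variable {Γ : Subgroup SL(2, ℤ)}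

/-! ### Clearing denominators of additive maps on finitely generated groups -/

/-- A finite-index level is finitely generated (Schreier; `SL(2, ℤ) = ⟨S, T⟩` is finitely generated:
`Literature.Geometry.Kaehler.ComplexTorus.QuaternionType.groupFG_SL2Z`). [folklore] -/
theorem fg_level [Γ.FiniteIndex] : Group.FG Γ := by
  haveI := Literature.Geometry.Kaehler.ComplexTorus.QuaternionType.groupFG_SL2Z
  infer_instance

/-- **Clearing denominators**: an additive map `u : G → ℚ` on a finitely generated group is `u'/d` for an INTEGRAL additive `u'` and some
`d ≠ 0` (`d` = the product of the denominators of `u` at a finite generating set). [folklore] -/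
theorem exists_int_eq_mul_of_additive {G : Type*} [Group G] [hG : Group.FG G] {u : G → ℚ} (hu : ∀ γ δ, u (γ * δ) = u γ + u δ) :
    ∃ d : ℤ, d ≠ 0 ∧ ∃ u' : G → ℤ, (∀ γ δ, u' (γ * δ) = u' γ + u' δ) ∧ ∀ γ, (u' γ : ℚ) = d * u γ := by
  obtain ⟨S₀, hS₀⟩ := hG.out
  set d : ℤ := ∏ s ∈ S₀, ((u s).den : ℤ) with hd
  have hd0 : d ≠ 0 := Finset.prod_ne_zero_iff.mpr fun s _ ↦ by exact_mod_cast (u s).den_nz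
  have h1 : u 1 = 0 := by
    have h := hu 1 1
    rw [mul_one] at h
    exact left_eq_add.mp h
  have hint : ∀ γ : G, ∃ m : ℤ, (d : ℚ) * u γ = m := by
    intro γ
    have hγ : γ ∈ Subgroup.closure (S₀ : Set G) := by rw [hS₀]; exact Subgroup.mem_top γ
    induction hγ using Subgroup.closure_induction with
    | mem s hs =>
      refine ⟨(∏ t ∈ S₀.erase s, ((u t).den : ℤ)) * (u s).num, ?_⟩
      rw [hd, ← Finset.mul_prod_erase S₀ _ (Finset.mem_coe.mp hs)]
      push_cast
      rw [mul_comm ((u s).den : ℚ), mul_assoc, Rat.den_mul_eq_num]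
    | one => exact ⟨0, by rw [h1]; simp⟩
    | mul x y _ _ hx hy =>
      obtain ⟨m, hm⟩ := hx
      obtain ⟨n, hn⟩ := hy
      exact ⟨m + n, by rw [hu, mul_add, hm, hn]; push_cast; ring⟩
    | inv x _ hx =>
      obtain ⟨m, hm⟩ := hx
      have hinv : u x⁻¹ = -u x := by
        have h := hu x⁻¹ x
        rw [inv_mul_cancel, h1] at h
        exact eq_neg_of_add_eq_zero_left h.symm
      exact ⟨-m, by rw [hinv, mul_neg, hm]; push_cast; ring⟩
  choose m hm using hint
  refine ⟨d, hd0, m, fun γ δ ↦ ?_, fun γ ↦ (hm γ).symm⟩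
  have h : ((m (γ * δ) : ℤ) : ℚ) = ((m γ + m δ : ℤ) : ℚ) := by
    push_cast
    rw [← hm, ← hm, ← hm, hu, mul_add]
  exact_mod_cast h

/-! ### `dim_ℚ H¹_{par,tors}(Γ, ℚ) ≤ r` for an integral basis `e₁, …, e_r` -/

/-- **The rational parabolic cocycles are spanned by an integral basis**: if every INTEGRAL additive parabolic-null `u : Γ → ℤ` has unique coordinates
in `e₁, …, e_r`, then `dim_ℚ parTorsCocycles ℚ Γ ≤ r` (clear denominators, expand, divide). [folklore] -/
theorem finrank_parTorsCocycles_rat_le [Γ.FiniteIndex] {r : ℕ} (e : Fin r → Γ → ℤ)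
    (huniq : ∀ u : Γ → ℤ, (∀ γ δ : Γ, u (γ * δ) = u γ + u δ) →
      (∀ γ : Γ, ((γ : SL(2, ℤ)) : Matrix (Fin 2) (Fin 2) ℤ).IsParabolic → u γ = 0) →
      ∃! c : Fin r → ℤ, u = fun γ ↦ ∑ i, c i * e i γ) :
    finrank ℚ (parTorsCocycles ℚ Γ) ≤ r := by
  haveI := fg_level (Γ := Γ)
  set ec : Fin r → Γ → ℚ := fun i γ ↦ (e i γ : ℚ) with hec
  set W : Submodule ℚ (Γ → ℚ) := Submodule.span ℚ (Set.range ec) with hW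
  haveI : FiniteDimensional ℚ W := FiniteDimensional.span_of_finite ℚ (Set.finite_range ec)
  have hle : parTorsCocycles ℚ Γ ≤ W := by
    intro u hu
    obtain ⟨hadd, hpar, -⟩ := (mem_parTorsCocycles_iff (K := ℚ)).mp hu
    obtain ⟨d, hd0, u', hu', hdu⟩ := exists_int_eq_mul_of_additive hadd
    have hpar' : ∀ γ : Γ, ((γ : SL(2, ℤ)) : Matrix (Fin 2) (Fin 2) ℤ).IsParabolic → u' γ = 0 := fun γ hγ ↦ by
      have h := hdu γ
      rw [hpar γ hγ, mul_zero] at h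
      exact_mod_cast h
    obtain ⟨c, hc, -⟩ := huniq u' hu' hpar'
    have hu_eq : u = ∑ i, ((c i : ℚ) / d) • ec i := by
      funext γ
      have hγ := hdu γ
      rw [hc] at hγ
      push_cast at hγ
      have hd0' : (d : ℚ) ≠ 0 := by exact_mod_cast hd0
      rw [Finset.sum_apply]
      simp only [Pi.smul_apply, smul_eq_mul, hec]
      rw [show u γ = (∑ i, (c i : ℚ) * (e i γ : ℚ)) / d from (eq_div_iff hd0').mpr (by rw [mul_comm]; exact hγ.symm),
        Finset.sum_div]
      exact Finset.sum_congr rfl fun i _ ↦ by ring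
    rw [hu_eq]
    exact W.sum_mem fun i _ ↦ W.smul_mem _ (Submodule.subset_span ⟨i, rfl⟩)
  calc finrank ℚ (parTorsCocycles ℚ Γ)
      ≤ finrank ℚ W := LinearMap.finrank_le_finrank_of_injective (f := Submodule.inclusion hle) (Submodule.inclusion_injective hle)
    _ ≤ r := by simpa [hW, Set.finrank] using finrank_range_le_card (R := ℚ) ec

/-! ### The rank bound at level `Γ` -/

/-- **The integral rank bound at level `Γ` (input `hV` of `parabolicCochain_modLift_of_rankBound`, level form)**: for a finite-index `Γ ∋ -1`, an
integral basis `e₁, …, e_r` (unique coordinates) of the additive parabolic-null maps `Γ → ℤ`, and a prime `p`, every `𝔽_p`-linearly independent family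
of additive maps `Γ → 𝔽_p` killing the parabolic and the finite-order elements has at most `r` members:
`s ≤ dim_{𝔽_p} H¹_{par,tors}(Γ, 𝔽_p) ≤ dim_ℚ H¹_{par,tors}(Γ, ℚ) ≤ r`. [cite: ShimuraIATAF1971, §8.1–8.2 (8.2.24), over `𝔽_p` and `ℚ`] -/
theorem rankBound_level [Γ.FiniteIndex] (hneg : (-1 : SL(2, ℤ)) ∈ Γ) {p : ℕ} [Fact p.Prime] {r : ℕ} (e : Fin r → Γ → ℤ)
    (huniq : ∀ u : Γ → ℤ, (∀ γ δ : Γ, u (γ * δ) = u γ + u δ) →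
      (∀ γ : Γ, ((γ : SL(2, ℤ)) : Matrix (Fin 2) (Fin 2) ℤ).IsParabolic → u γ = 0) →
      ∃! c : Fin r → ℤ, u = fun γ ↦ ∑ i, c i * e i γ)
    {s : ℕ} (v : Fin s → Γ → ZMod p)
    (hv : ∀ i, (∀ γ δ : Γ, v i (γ * δ) = v i γ + v i δ) ∧ (∀ γ : Γ, IsOfFinOrder γ → v i γ = 0) ∧
      ∀ γ : Γ, ((γ : SL(2, ℤ)) : Matrix (Fin 2) (Fin 2) ℤ).IsParabolic → v i γ = 0)
    (hli : LinearIndependent (ZMod p) v) : s ≤ r := by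
  haveI := finite_parTorsCocycles (ZMod p) Γ
  -- the family inside `H¹_{par,tors}(Γ, 𝔽_p)`
  let w : Fin s → parTorsCocycles (ZMod p) Γ := fun i ↦ ⟨v i, (hv i).1, (hv i).2.2, (hv i).2.1⟩
  have hw : LinearIndependent (ZMod p) w := by
    apply LinearIndependent.of_comp (parTorsCocycles (ZMod p) Γ).subtype
    exact hli
  have h1 : s ≤ finrank (ZMod p) (parTorsCocycles (ZMod p) Γ) := by simpa using hw.fintype_card_le_finrank
  have h2 := finrank_parTorsCocycles_le_of_charZero (K := ℚ) (L := ZMod p) (Γ := Γ) hneg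
  have h3 := finrank_parTorsCocycles_rat_le (Γ := Γ) e huniq
  omega

/-- **Corollary: `dim_{𝔽_p} H¹_{par,tors}(Γ, 𝔽_p) ≤ r`** in the same situation. [folklore] -/
theorem finrank_parTorsCocycles_zmod_le [Γ.FiniteIndex] (hneg : (-1 : SL(2, ℤ)) ∈ Γ) {p : ℕ} [Fact p.Prime] {r : ℕ} (e : Fin r → Γ → ℤ)
    (huniq : ∀ u : Γ → ℤ, (∀ γ δ : Γ, u (γ * δ) = u γ + u δ) →
      (∀ γ : Γ, ((γ : SL(2, ℤ)) : Matrix (Fin 2) (Fin 2) ℤ).IsParabolic → u γ = 0) →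
      ∃! c : Fin r → ℤ, u = fun γ ↦ ∑ i, c i * e i γ) :
    finrank (ZMod p) (parTorsCocycles (ZMod p) Γ) ≤ r :=
  (finrank_parTorsCocycles_le_of_charZero (K := ℚ) (L := ZMod p) (Γ := Γ) hneg).trans (finrank_parTorsCocycles_rat_le e huniq)

end Summit.BirchSwinnertonDyer.BirchSwinnertonDyer.Theorems.EichlerShimuraLevelK

end
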